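/-
Copyright (c) 2026. All rights reserved.
Released under Apache 2.0 license as described in the file LICENSE.
Authors: abc-iut cell, prover seat abc-iut-L4-t12 (gen 8).
-/
import Literature.AnabelianGeometry.AbsoluteAnabelian.ArchimedeanHolFieldFunctorGeometricRC
import Literature.AnabelianGeometry.AbsoluteAnabelian.ArchimedeanHolFieldFunctorGeometricOverIdRigidInstances
import Literature.AnabelianGeometry.AbsoluteAnabelian.RCHolomorphicInverse
import HarnessLib

/-!
# [AbsTopIII] Prop 4.2 (i), print-faithful `RC` column: the slice of `HolRS.RC` over `𝕏` is the slice
# of `HolRS` over `𝕏` (hence ≌ the connected finite covers of `𝕏^top`, hence id-rigid from (3ε))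

abc-iut cell, campaign-L item R1.2 of the `EA` column of [AbsTopIII] Prop 4.2 / Cor 4.5 (classical).
S. Mochizuki, *Topics in Absolute Anabelian Geometry III*, proof of Prop 4.2 (i), kurims p.106 l.11–19:
«the full subcategory of `EA` consisting of objects that map to `X` may, by Corollary 2.3, (i) …, be
identified with the category of finite étale R-localizations».  Print's `EA ⊆ TH` has ALL finite étale
morphisms of Aut-holomorphic orbispaces, which between Riemann surfaces are the RC-HOLOMORPHIC finite
étale maps (Cor 2.3 (i)) — abc-iut-L4-t14's category `HolRS.RC` (`ArchimedeanHolFieldFunctorGeometricRC`,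
`geometricAutHolFieldFunctorRC`), of which the holomorphic `HolRS` is the co-oriented half.  abc-iut-L4-t12
(gen 7) identified the slice of `HolRS` over `𝕏` with the connected finite covers of `𝕏^top`
(`HolRS.overEquivConnectedCovFin`) and deduced its id-rigidity from (3ε) (`Z(π̂₁) = 1`).  THIS FILE does
the same for the print-faithful `RC`:

* §1 `IsHolAt.congr_of_eventuallyEq`, `IsAntiHolAt.congr_of_eventuallyEq` — (anti-)holomorphy at a
  point depends only on the germ;
* §2 **RC RIGIDITY OVER A HOLOMORPHIC LOCAL BIHOLOMORPHISM** (`isHolAt_of_isLocalDiffeomorph_comp`,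
  `isAntiHolAt_of_isLocalDiffeomorph_comp`, `isRCHolomorphic_of_isLocalDiffeomorph_comp`): if `π : T → B`
  is a holomorphic local `C^ω`-diffeomorphism and `g : S → T` is continuous with `π ∘ g` holomorphic
  (resp. anti-holomorphic) at `s`, then so is `g` — `g = π⁻¹_loc ∘ (π ∘ g)` near `s` (Mathlib's
  `IsLocalDiffeomorphAt.localInverse`) and the parities hol∘hol, hol∘anti of abc-iut-L4-t8's
  `RCHolomorphicCalculus`; the RC form of Lin's «maps over the base into an étale space are analytic»;
* §3 `HolRS.toRC : HolRS ⥤ RC` (the co-oriented half as a subcategory, faithful); for an RC-holomorphic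
  finite étale `f : 𝕐 → 𝕏` the IDENTITY map from `𝕐` to `𝕐^top` re-structured by pulling back `𝕏`'s
  complex structure along `f` (gen 7's `HolRS.ofCover`, for which `f` becomes HOLOMORPHIC) is an
  RC-holomorphic isomorphism OVER `𝕏` (`RCHom.isRCHolomorphic_toOfCover`; it is anti-holomorphic exactly
  when `f` is — the «conjugate Riemann surface» `𝕐̄` realised without conjugate charts);
* §4 **`HolRS.RC.overEquiv 𝕏 : Over 𝕏 ≌ Over (⟨𝕏⟩ : RC)`** — `Over.post toRC` is fully faithful
  (a morphism over `𝕏` between objects with holomorphic structure maps is holomorphic, gen 7's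
  `HolRS.homOfOver`) and essentially surjective (§3); **`HolRS.RC.overEquivConnectedCovFin 𝕏 :
  Over (⟨𝕏⟩ : RC) ≌ {connected finite covers of 𝕏^top}`**;
* §5 consequences: `RC.isIdRigid_over_iff`, **`RC.isIdRigid_over_of_center_eq_bot`** (the RC slice
  over `𝕏` is id-rigid when `Z(π̂₁(𝕏^top)) = 1`), and UNCONDITIONALLY `RC.isIdRigid_over_planeComplFinite`
  (`ℂ ∖ F`, `2 ≤ |F| < ∞`), `RC.isIdRigid_over_thricePuncturedSphere`.

HONEST SCOPE.  This is the (H2)/slice half of the EA column for the print-faithful morphisms; the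
EA-level statement «objects of `EA_RC(Q)` mapping to `𝕏` is id-rigid» is NOT claimed here.  Informal
remark (not formalised): in `RC` the sufficient per-object criterion (H1) of
`ArchimedeanHolFieldFunctorGeometricOverIdRigid` is not available at the thrice-punctured sphere —
complex conjugation commutes with the six anharmonic automorphisms (real coefficients), so it is a
non-trivial central element of `Aut_RC(ℂ ∖ {0,1}) ≅ 𝔖₃ × C₂` — and the EA-level input there is the cell's
(H1′)/descent route (abc-iut-w6-d003 `IdRigidEpiCoverDescent`, abc-iut-w5-d144, abc-iut-L4-t14's
`LocCategoryGroupModel`), which composes with the present (H2).  Model level; orbicurves, uniformisation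
and Lemma 4.3 untouched; nothing here bears on [IUTchIII] Cor. 3.12; model ≠ reconstruction; support
library, not a node.  Definitions: the functor `HolRS.toRC` and the two bundled equivalences
(packaging); no instances, no Prop facts.

## References

* S. Mochizuki, *Topics in Absolute Anabelian Geometry III*, kurims ms, proof of Prop 4.2 (i) p.106
  l.11–19; Cor 2.3 (i) p.53; Def 4.1 (i)/(iii) pp.101–103. [MochizukiAbsTopIII2015]
* I-Hsiung Lin, *Classical complex analysis: a geometric approach*, vol. 2 (2011), (7.5.2.1) p.449. [Lin2011]
-/

noncomputable section

open CategoryTheory Set Filter Function Topology TopologicalSpace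
open scoped Manifold ContDiff ComplexConjugate
open Literature.Topology.CoveringSpaces

namespace Literature.AnabelianGeometry.AbsoluteAnabelian

universe u

/-! ### §1 (Anti-)holomorphy at a point depends only on the germ -/

section Congr

variable {M N : Type u} [TopologicalSpace M] [ChartedSpace ℂ M] [TopologicalSpace N] [ChartedSpace ℂ N]

/-- Holomorphy at a point is a property of the germ: if `f` is holomorphic at `x` and `g = f` near `x`
then `g` is holomorphic at `x`. [cite: MochizukiAbsTopIII2015, Definition 2.1 (ii) p.51] -/
theorem IsHolAt.congr_of_eventuallyEq {f g : M → N} {x : M} (h : IsHolAt f x) (hfg : f =ᶠ[𝓝 x] g) :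
    IsHolAt g x := by
  filter_upwards [h, hfg.eventuallyEq_nhds] with y hy hfgy
  exact hy.congr_of_eventuallyEq hfgy.symm

/-- Anti-holomorphy at a point is a property of the germ: if `f` is anti-holomorphic at `x` and `g = f`
near `x` then `g` is anti-holomorphic at `x` (the chart expressions of `f` and `g` at nearby points agree
near the chart image). [cite: MochizukiAbsTopIII2015, Definition 2.1 (ii) p.51] -/
theorem IsAntiHolAt.congr_of_eventuallyEq {f g : M → N} {x : M} (h : IsAntiHolAt f x)
    (hfg : f =ᶠ[𝓝 x] g) : IsAntiHolAt g x := by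
  filter_upwards [h, hfg.eventuallyEq_nhds] with y hy hfgy
  obtain ⟨hc, hd⟩ := hy
  have hyeq : f y = g y := hfgy.self_of_nhds
  refine ⟨hc.congr hfgy, ?_⟩
  have hz : extChartAt 𝓘(ℂ, ℂ) y y = chartAt ℂ y y := extChartAt_apply_eq y y
  have hsymm : Tendsto (chartAt ℂ y).symm (𝓝 (chartAt ℂ y y)) (𝓝 y) := by
    have h1 : ContinuousAt (chartAt ℂ y).symm (chartAt ℂ y y) :=
      (chartAt ℂ y).continuousAt_symm (mem_chart_target ℂ y)
    have h2 : (chartAt ℂ y).symm (chartAt ℂ y y) = y := (chartAt ℂ y).left_inv (mem_chart_source ℂ y)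
    simpa only [ContinuousAt, h2] using h1
  have hW : (conj ∘ writtenInExtChartAt 𝓘(ℂ, ℂ) 𝓘(ℂ, ℂ) y g) =ᶠ[𝓝 (extChartAt 𝓘(ℂ, ℂ) y y)]
      (conj ∘ writtenInExtChartAt 𝓘(ℂ, ℂ) 𝓘(ℂ, ℂ) y f) := by
    rw [hz]
    filter_upwards [hsymm.eventually hfgy] with w hw
    simp only [Function.comp_apply, writtenInExtChartAt_apply_eq, hw, hyeq]
  exact hd.congr_of_eventuallyEq hW

end Congr

/-! ### §2 RC rigidity over a holomorphic local biholomorphism -/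

section RCRigidity

variable {S T B : Type u} [TopologicalSpace S] [ChartedSpace ℂ S]
  [TopologicalSpace T] [ChartedSpace ℂ T] [TopologicalSpace B] [ChartedSpace ℂ B]

/-- The chosen local inverse of a holomorphic local `C^ω`-diffeomorphism at `t` is holomorphic at `π t`
(it is `C^ω` on its open source, which contains `π t`). [cite: Lin2011, (7.5.2.1) p.449] -/
theorem isHolAt_localInverse {π : T → B} {t : T} (hπ : IsLocalDiffeomorphAt 𝓘(ℂ, ℂ) 𝓘(ℂ, ℂ) ω π t) :
    IsHolAt hπ.localInverse (π t) := by
  filter_upwards [hπ.localInverse_open_source.mem_nhds hπ.localInverse_mem_source] with z hz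
  exact (hπ.localInverse_contMDiffOn.contMDiffAt (hπ.localInverse_open_source.mem_nhds hz)).mdifferentiableAt
    (by simp)

/-- **RC rigidity, holomorphic case**: for a holomorphic local `C^ω`-diffeomorphism `π : T → B` and a map
`g : S → T` continuous at `s` with `π ∘ g` holomorphic at `s`, `g` is holomorphic at `s`
(`g = π⁻¹_loc ∘ (π ∘ g)` near `s`). [cite: Lin2011, (7.5.2.1) p.449] -/
theorem isHolAt_of_isLocalDiffeomorph_comp {g : S → T} {π : T → B} {s : S}
    (hπ : IsLocalDiffeomorph 𝓘(ℂ, ℂ) 𝓘(ℂ, ℂ) ω π) (hg : ContinuousAt g s) (h : IsHolAt (π ∘ g) s) :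
    IsHolAt g s := by
  have hl := hπ (g s)
  have hev : (hl.localInverse ∘ (π ∘ g)) =ᶠ[𝓝 s] g := by
    filter_upwards [hg.eventually hl.localInverse_eventuallyEq_left] with y hy
    simpa only [Function.comp_apply, id_eq] using hy
  exact (IsHolAt.comp (f := π ∘ g) (x := s) (isHolAt_localInverse hl) h).congr_of_eventuallyEq hev

/-- **RC rigidity, anti-holomorphic case**: for a holomorphic local `C^ω`-diffeomorphism `π : T → B` and
a map `g : S → T` continuous at `s` with `π ∘ g` ANTI-holomorphic at `s`, `g` is anti-holomorphic at `s`
(hol ∘ anti = anti, abc-iut-L4-t8's `IsHolAt.comp_isAntiHolAt`). [cite: MochizukiAbsTopIII2015, Corollary 2.3 (i) p.53] -/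
theorem isAntiHolAt_of_isLocalDiffeomorph_comp {g : S → T} {π : T → B} {s : S}
    (hπ : IsLocalDiffeomorph 𝓘(ℂ, ℂ) 𝓘(ℂ, ℂ) ω π) (hg : ContinuousAt g s) (h : IsAntiHolAt (π ∘ g) s) :
    IsAntiHolAt g s := by
  have hl := hπ (g s)
  have hev : (hl.localInverse ∘ (π ∘ g)) =ᶠ[𝓝 s] g := by
    filter_upwards [hg.eventually hl.localInverse_eventuallyEq_left] with y hy
    simpa only [Function.comp_apply, id_eq] using hy
  exact (IsHolAt.comp_isAntiHolAt (f := π ∘ g) (x := s) (isHolAt_localInverse hl) h).congr_of_eventuallyEq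
    hev

/-- **RC rigidity**: for a holomorphic local `C^ω`-diffeomorphism `π : T → B`, a continuous `g : S → T`
with `π ∘ g` RC-holomorphic is RC-holomorphic (of the same type pointwise). [cite: MochizukiAbsTopIII2015, Corollary 2.3 (i) p.53] -/
theorem isRCHolomorphic_of_isLocalDiffeomorph_comp {g : S → T} {π : T → B}
    (hπ : IsLocalDiffeomorph 𝓘(ℂ, ℂ) 𝓘(ℂ, ℂ) ω π) (hg : Continuous g) (h : IsRCHolomorphic (π ∘ g)) :
    IsRCHolomorphic g := fun s =>
  (h s).imp (isHolAt_of_isLocalDiffeomorph_comp hπ hg.continuousAt)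
    (isAntiHolAt_of_isLocalDiffeomorph_comp hπ hg.continuousAt)

end RCRigidity

namespace HolRS

/-! ### §3 `HolRS ⥤ RC`; RC rigidity over `𝕏`; the identity onto the pulled-back structure -/

/-- **The co-oriented half as a subcategory**: the functor `HolRS ⥤ RC` which is the identity on objects
and regards a holomorphic finite étale map as an RC-holomorphic one.
[cite: MochizukiAbsTopIII2015, Definition 4.1 (iii) p.103] -/
def toRC : HolRS ⥤ RC where
  obj X := ⟨X⟩
  map f := ⟨f.toFun, fun x => Or.inl (Hom.isHolAt f x), f.isFiniteEtale⟩

/-- `toRC` on objects. [cite: MochizukiAbsTopIII2015, Definition 4.1 (iii) p.103] -/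
@[simp] theorem toRC_obj (X : HolRS) : toRC.obj X = ⟨X⟩ := rfl

/-- `toRC` on morphisms: the same underlying map. [cite: MochizukiAbsTopIII2015, Definition 4.1 (iii) p.103] -/
@[simp] theorem toRC_map_toFun {X Y : HolRS} (f : X ⟶ Y) : (toRC.map f).toFun = f.toFun := rfl

/-- `toRC` is faithful. [cite: MochizukiAbsTopIII2015, Definition 4.1 (iii) p.103] -/
theorem toRC_faithful : toRC.Faithful :=
  ⟨fun {_ _} _ _ h => hom_ext (congrArg RCHom.toFun h)⟩

/-- **RC rigidity over `𝕏`**: for an RC-holomorphic finite étale `f_𝕐 : 𝕐 → 𝕏` and a HOLOMORPHIC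
finite étale `f_ℤ : ℤ → 𝕏`, every continuous `g : 𝕐 → ℤ` with `f_ℤ ∘ g = f_𝕐` is RC-holomorphic.
[cite: MochizukiAbsTopIII2015, proof of Proposition 4.2, p.106 l.11–19] [cite: Lin2011, (7.5.2.1) p.449] -/
theorem RCHom.isRCHolomorphic_of_comp_eq {X Y Z : HolRS} (fY : RCHom Y X) (fZ : Z ⟶ X)
    {g : Y.carrier → Z.carrier} (hg : Continuous g) (h : fZ.toFun ∘ g = fY.toFun) :
    IsRCHolomorphic g :=
  isRCHolomorphic_of_isLocalDiffeomorph_comp fZ.isLocalDiffeomorph hg (h ▸ fY.isRCHolomorphic)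

section ToOfCover

/-- **The identity from `𝕐` onto `𝕐^top` with the complex structure pulled back along an RC-holomorphic
finite étale `f : 𝕐 → 𝕏` is RC-holomorphic** (it lies over `𝕏`, and the pulled-back structure map
`HolRS.ofCoverHom` is a holomorphic local biholomorphism); it is holomorphic where `f` is and
anti-holomorphic where `f` is — the conjugate Riemann surface `𝕐̄` when `f` is anti-holomorphic.
[cite: Lin2011, (7.5.2.1) p.449] [cite: MochizukiAbsTopIII2015, Corollary 2.3 (i) p.53] -/
theorem RCHom.isRCHolomorphic_toOfCover (X : HolRS) {Y : HolRS} (f : RCHom Y X) :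
    IsRCHolomorphic (X := Y.carrier)
      (Y := (X.ofCover f.isFiniteEtale.isCoveringMap f.isFiniteEtale.finite_fibre).carrier) fun y => y :=
  RCHom.isRCHolomorphic_of_comp_eq (g := fun y => y) f
    (X.ofCoverHom f.isFiniteEtale.isCoveringMap f.isFiniteEtale.finite_fibre) continuous_id rfl

/-- … and so is its inverse (the inverse of an RC-holomorphic homeomorphism, abc-iut-L4-t8's / abc-iut-w5-d053's
`IsRCHolomorphic.symm_homeomorph`). [cite: MochizukiAbsTopIII2015, Corollary 2.3 (i) p.53] -/
theorem RCHom.isRCHolomorphic_ofOfCover (X : HolRS) {Y : HolRS} (f : RCHom Y X) :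
    IsRCHolomorphic (X := (X.ofCover f.isFiniteEtale.isCoveringMap f.isFiniteEtale.finite_fibre).carrier)
      (Y := Y.carrier) fun y => y :=
  -- `@id` pins the type (and hence the pulled-back instances) of the identity homeomorphism
  IsRCHolomorphic.symm_homeomorph
    (@id (Y.carrier ≃ₜ (X.ofCover f.isFiniteEtale.isCoveringMap f.isFiniteEtale.finite_fibre).carrier)
      (Homeomorph.refl Y.carrier))
    (RCHom.isRCHolomorphic_toOfCover X f)

/-- **`𝕐 ≅ (𝕐^top, f^* structure)` in `RC`, over `𝕏`**: the identity map and its inverse are mutually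
inverse RC-holomorphic finite étale maps, and the isomorphism commutes with the structure maps to `𝕏`
(`f` itself, resp. the holomorphic `HolRS.ofCoverHom`). [cite: MochizukiAbsTopIII2015, proof of Proposition 4.2, p.106 l.11–19] -/
theorem RC.exists_iso_ofCover (X : HolRS) {Y : HolRS} (f : RCHom Y X) :
    ∃ e : toRC.obj (X.ofCover f.isFiniteEtale.isCoveringMap f.isFiniteEtale.finite_fibre) ≅ (⟨Y⟩ : RC),
      (e.hom.toFun = fun y => y) ∧
        e.hom ≫ (f : (⟨Y⟩ : RC) ⟶ ⟨X⟩) =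
          toRC.map (X.ofCoverHom f.isFiniteEtale.isCoveringMap f.isFiniteEtale.finite_fibre) := by
  refine ⟨⟨⟨fun y => y, RCHom.isRCHolomorphic_ofOfCover X f,
      IsFiniteEtale.of_homeomorph
        (X := (X.ofCover f.isFiniteEtale.isCoveringMap f.isFiniteEtale.finite_fibre).carrier)
        (Y := Y.carrier) (Homeomorph.refl Y.carrier)⟩,
    ⟨fun y => y, RCHom.isRCHolomorphic_toOfCover X f,
      IsFiniteEtale.of_homeomorph (X := Y.carrier)
        (Y := (X.ofCover f.isFiniteEtale.isCoveringMap f.isFiniteEtale.finite_fibre).carrier)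
        (Homeomorph.refl Y.carrier)⟩,
    RC.hom_ext rfl, RC.hom_ext rfl⟩, rfl, RC.hom_ext rfl⟩

end ToOfCover

/-! ### §4 `Over 𝕏 ≌ Over (⟨𝕏⟩ : RC)` -/

section OverEquiv

variable (X : HolRS)

/-- `Over.post toRC : Over 𝕏 ⥤ Over ⟨𝕏⟩` is faithful. [cite: MochizukiAbsTopIII2015, Definition 4.1 (iii) p.103] -/
theorem overPost_toRC_faithful : (Over.post (X := X) toRC).Faithful where
  map_injective {A₁ A₂} g₁ g₂ h := by
    ext1
    apply hom_ext
    exact congrArg (fun k : (Over.post toRC).obj A₁ ⟶ (Over.post toRC).obj A₂ => k.left.toFun) h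

/-- **`Over.post toRC` is full**: an RC-holomorphic finite étale map OVER `𝕏` between objects whose
structure maps are holomorphic is holomorphic (rigidity, gen 7's `HolRS.homOfOver`).
[cite: MochizukiAbsTopIII2015, proof of Proposition 4.2, p.106 l.11–19] [cite: Lin2011, (7.5.2.1) p.449] -/
theorem overPost_toRC_full : (Over.post (X := X) toRC).Full where
  map_surjective {A₁ A₂} k := by
    have hw : A₂.hom.toFun ∘ k.left.toFun = A₁.hom.toFun := congrArg RCHom.toFun (Over.w k)
    refine ⟨Over.homMk (homOfOver A₁.hom A₂.hom k.left.toFun k.left.isFiniteEtale hw)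
      (homOfOver_comp _ _ _ _ _), ?_⟩
    ext1
    exact RC.hom_ext rfl

/-- **`Over.post toRC` is essentially surjective**: every RC-object over `𝕏` is isomorphic over `𝕏` to
the holomorphic `HolRS.ofCover` of its underlying finite cover (§3).
[cite: MochizukiAbsTopIII2015, proof of Proposition 4.2, p.106 l.11–19] [cite: Lin2011, (7.5.2.1) p.449] -/
theorem overPost_toRC_essSurj : (Over.post (X := X) toRC).EssSurj where
  mem_essImage B := by
    obtain ⟨e, -, he⟩ := RC.exists_iso_ofCover X (Y := B.left.of) B.hom
    exact ⟨Over.mk (X.ofCoverHom B.hom.isFiniteEtale.isCoveringMap B.hom.isFiniteEtale.finite_fibre),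
      ⟨Over.isoMk e he⟩⟩

/-- `Over.post toRC` is an equivalence of categories. [cite: MochizukiAbsTopIII2015, proof of Proposition 4.2, p.106 l.11–19] -/
theorem overPost_toRC_isEquivalence : (Over.post (X := X) toRC).IsEquivalence :=
  haveI := overPost_toRC_faithful X
  haveI := overPost_toRC_full X
  haveI := overPost_toRC_essSurj X
  Functor.IsEquivalence.mk

/-- **`Over 𝕏 ≌ Over (⟨𝕏⟩ : RC)`**: over a fixed connected Riemann surface, the slice of the holomorphic
category and the slice of the print-faithful RC-holomorphic category agree (every RC-object over `𝕏` is
RC-isomorphic over `𝕏` to a holomorphic one; morphisms over `𝕏` between holomorphic objects are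
holomorphic). [cite: MochizukiAbsTopIII2015, proof of Proposition 4.2, p.106 l.11–19] -/
def RC.overEquiv : Over X ≌ Over (⟨X⟩ : RC) :=
  haveI := overPost_toRC_isEquivalence X
  (Over.post (X := X) toRC).asEquivalence

/-- **`Over (⟨𝕏⟩ : RC) ≌ {connected finite covering spaces of 𝕏^top}`** — the print-faithful slice
junction: objects of `RC` over `𝕏`, with RC-holomorphic morphisms over `𝕏`, are the connected finite
covers of `𝕏^top` with continuous maps over `𝕏^top` (gen 7's `overEquivConnectedCovFin` precomposed
with `RC.overEquiv`). [cite: MochizukiAbsTopIII2015, proof of Proposition 4.2, p.106 l.11–19]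
[cite: Lin2011, (7.5.2.1) p.449] -/
def RC.overEquivConnectedCovFin : Over (⟨X⟩ : RC) ≌ (IsConnectedCover X.carrier).FullSubcategory :=
  (RC.overEquiv X).symm.trans X.overEquivConnectedCovFin

end OverEquiv

/-! ### §5 Id-rigidity of the RC slice -/

section IdRigid

open Literature.AlgebraicGeometry.Frobenioids (IsSlimGroup)
open Literature.IUT.HodgeTheaters (profiniteCompletion)

variable (X : HolRS)

/-- The RC slice over `𝕏` is id-rigid iff the holomorphic slice is. [cite: MochizukiAbsTopIII2015, Proposition 4.2 (i) p.106] -/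
theorem RC.isIdRigid_over_iff : IsIdRigid (Over (⟨X⟩ : RC)) ↔ IsIdRigid (Over X) :=
  (isIdRigid_iff_of_equivalence_univ (RC.overEquiv X)).symm

/-- **(H2) for the print-faithful morphisms**: the slice of `RC` over `𝕏` is id-rigid as soon as the
connected finite covers of `𝕏^top` form an id-rigid category. [cite: MochizukiAbsTopIII2015, Proposition 4.2 (i) p.106] -/
theorem RC.isIdRigid_over_of_isIdRigid_connectedCover
    (h : IsIdRigid (IsConnectedCover X.carrier).FullSubcategory) : IsIdRigid (Over (⟨X⟩ : RC)) :=
  (RC.isIdRigid_over_iff X).2 (X.isIdRigid_over_of_isIdRigid_connectedCover h)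

/-- **The RC slice over `𝕏` is id-rigid when `Z(π̂₁(𝕏^top, x₀)) = 1`**: every automorphism of the identity
functor of the category of connected Riemann surfaces RC-holomorphic finite étale over `𝕏` (RC morphisms
over `𝕏`) is trivial. [cite: MochizukiAbsTopIII2015, Proposition 4.2 (i) p.106] -/
theorem RC.isIdRigid_over_of_center_eq_bot (x₀ : X.carrier)
    (hZ : Subgroup.center (profiniteCompletion (FundamentalGroup X.carrier x₀)) = ⊥) :
    IsIdRigid (Over (⟨X⟩ : RC)) :=
  (RC.isIdRigid_over_iff X).2 (X.isIdRigid_over_of_center_eq_bot x₀ hZ)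

/-- The RC slice over `𝕏` is id-rigid when `π̂₁(𝕏^top, x₀)` is slim (print's Lemma 4.3 input).
[cite: MochizukiAbsTopIII2015, Lemma 4.3 p.106] -/
theorem RC.isIdRigid_over_of_isSlimGroup (x₀ : X.carrier)
    (h : IsSlimGroup (profiniteCompletion (FundamentalGroup X.carrier x₀))) :
    IsIdRigid (Over (⟨X⟩ : RC)) :=
  (RC.isIdRigid_over_iff X).2 (X.isIdRigid_over_of_isSlimGroup x₀ h)

/-- **UNCONDITIONAL: the RC slice over `ℂ ∖ F` is id-rigid** for `F` finite with `2 ≤ |F|`.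
[cite: MochizukiAbsTopIII2015, Proposition 4.2 (i) p.106] -/
theorem RC.isIdRigid_over_planeComplFinite {F : Set ℂ} (hF : F.Finite) (h2 : 2 ≤ F.ncard) :
    IsIdRigid (Over (⟨planeComplFinite F hF⟩ : RC)) :=
  (RC.isIdRigid_over_iff _).2 (HolRS.isIdRigid_over_planeComplFinite hF h2)

/-- **UNCONDITIONAL: the RC slice over the thrice-punctured sphere `ℂ ∖ {0, 1}` is id-rigid.**
[cite: MochizukiAbsTopIII2015, Proposition 4.2 (i) p.106] -/
theorem RC.isIdRigid_over_thricePuncturedSphere :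
    IsIdRigid (Over (⟨planeComplFinite ({0, 1} : Set ℂ) (Set.toFinite _)⟩ : RC)) :=
  (RC.isIdRigid_over_iff _).2 HolRS.isIdRigid_over_thricePuncturedSphere

end IdRigid

end HolRS

end Literature.AnabelianGeometry.AbsoluteAnabelian
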